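import Summits.ABC.IUTFork.Repair.RHReqsidePairPK32M2764
import HarnessLib

/-!
# D-0122 AXIS B, REQB-TABLE v1 row «P-k1kappa3/2-k5mu1/2» (KEY PK32M12) — THE PAIR'S KERNEL FACE, BY NAME:
# (a) the declared map `κ = 3/2` at the worked place FREY `p = 7`, `l = 107` (all 53 labels licensed, `j₀,mod = 53 = l⋆`) and (b) the single deciding-tier
# comparison `½·M_mod ≤ K_L1,mod` PER DATUM on FREY133 + HEX79 (COUNT 133/133 ∧ 79/79), as the `μ₀ = ½` members of the sibling row PK32M2764's face (p515841)

COMPUTED TABLE ROW TRANSCRIBED / RE-DERIVED ≠ theorem about IUT. PROOF-ONLY file (0 definitions; seat abc-iut-rh-typ-1 GEN 10, keyed row PK32M12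
`wake/KEY-abc-iut-rh-typ-1-PK32M12.md` (priority8 2026-08-27 08:17:58Z; abc-iut-rh-lead g4 R71-A 09:55:23Z keeps the key on this base); owner abc-iut-rh-lead g4,
ruling R63 (B) 08:33:07Z: (1) dedup first, (2) one file per row, PROOF-ONLY, defs imported from p506542 / p508156 / p505937 / p507493 / p509351 only, (4) «these
faces HARDEN Part (II) and change NO word, count or answer of the 12:00Z letter»). DEDUP VERDICT (rule (1)): the `μ₀ = ½` deciding-tier content is ALREADY in the
tree as CONJUNCTS of named theorems — sibling p515841 `Repair/RHReqsidePairPK32M2764.lean` (abc-iut-rh-typ-2 g12) proves `pairPK32M2764_datum_of_places` with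
BOTH targets `27/64 ∧ ½`, and abc-iut-reqb-typ-1's p514474 `exception_datum_k32_words_L1` carries the `μ₀ = ½` word of the one exception datum as its second
conjunct; what was NOT yet a theorem BY NAME is this row's SINGLE-target face (`μ₀ = ½` alone, per datum / at the exception datum / at the worked place), its
place-wise integer shape `2·DD_w ≤ MM_w`, and the ratio identity `ρ(½) = 2·μ_L1` that explains the row's cells — typed here as a THIN file citing the sibling
and the bed files by name (pattern of `Repair/RHReqsidePairPK3CM12.lean`, rh-lead g3 R68 B353). NOTHING is re-run over a bed: no bed numeral is restated, no
`decide` runs over place tables; the only kernel evaluations are `2·0 ≤ 1752450`-sized.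
Spec `plan/rescue/R-H/ROUND3/REQB-SPEC.md` v0.2 ff7e3c55f4ddda0e §6 = R46 ((P2) ratio of record `ρ := K_L1,mod/(μ₀·M_mod)`, tier L1 = (EX, none); (P3) deciding
statistic = THE COUNT `n_{ρ ≥ 1}`; (P6) third engine = the worked place recomputed per row from the declared map).

THE ROW OF RECORD (`R/ROUND3/REQB-TABLE.tsv` v1 b8ac679ede5d795b = abc-iut-reqb-ref-1 REQB-SIGNED-ref-1-v1.tsv a23349b525227fe7, `.tsv` l.17 / l.18, the two rows
VERBATIM, cells separated by « · »; engines A (abc-iut-reqb-lp-1) ≡ B (abc-iut-reqb-lp-2), CERT-AB-ALL-v411 41a7fc45c940dd1b):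
«P-k1kappa3/2-k5mu1/2 · FREY133 · 133 · k1=kappa:3/2 k2=print c=1 cD=1 pk=j+1 rnd=floor mu0=1/2 · MEETS · 133/133 · 1.9824 · 2.0000 · 1.4862 · 0.7431 · yes ·
REDUCES-STRONGLY · 0.0005 · 0.0000 · 8 · 54 · 0.957 · 9.545 · 5.482 · 11555.6 · bed-height only (WINDOW-PERSISTENT 0/133) · baseline (demand/label/target side only) ·
NEW-THEORY · k1=kappa:3/2: NEW-THEORY (rf-1 k1.κ32: Δ²⌈j^{3/2}⌉ non-constant ⇒ no theta-type section, EtTh p.12–13, p.17 l.8–13 [L2]); k5=1/2: DEFINABLE (rf-1 k5.μ½: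
λ-link [L4] (l=107: λ = 482); outcome C_Θ ≥ −λ) · KEPT-WITH-NEW-THEORY-TAG (R8-eligible) — NEW-THEORY · yes · SIGN» and
«P-k1kappa3/2-k5mu1/2 · HEX79 · 79 · k1=kappa:3/2 k2=print c=1 cD=1 pk=j+1 rnd=floor mu0=1/2 · MEETS · 79/79 · 1.9970 · 2.0000 · 1.8871 · 0.9436 · yes · VANISHES ·
0.0000 · 0.0000 · 8 · 86 · 0.992 · 20.001 · 12.836 · 11950.4 · bed-height only (WINDOW-PERSISTENT 0/79) · baseline (demand/label/target side only) · NEW-THEORY ·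
(same consistency cell) · KEPT-WITH-NEW-THEORY-TAG (R8-eligible) — NEW-THEORY · yes · SIGN».
(Columns: point_id · bed · n · knobs · COUNT_WORD · n_rho>=1 · rho_pooled · rho_lowmed · rho_min · muL1_min · R8_partner_raises_mu_min · T_word · Tmod/T_pooled ·
Tmod/T_med · j0_med · j0_p90 · share_full · crossR_sx_med · crossR_sx_min · crossR_hx_max · WINDOW · cone · CONSISTENCY · consistency_loci · VERDICT · AB_agree · SIGN.
«R8_partner_raises_mu_min · yes»: the `κ = 3/2` partner raises `μ_L1,min` against the k5-only PRIOR row S-k5-1/2 — 0.6153 ↦ 0.7431 FREY133, 0.8096 ↦ 0.9436 HEX79,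
`.tsv` l.99 / l.100.)
CONSISTENCY WORD with loci ids, verbatim (abc-iut-reqb-rf-2 `LOCI-TABLE-PartII-rf-2.md` 16962e2ffdef058e, .md rows 2 / 9 / 10 = `.tsv` 4a4e8af55ab5f4bf l.3 / l.10 /
l.11; ids resolve in `LOCI-rf-2.tsv` 6c7aff5d032053f6 and rf-1 `loci.tsv`): row 2 «k1 κ ∈ {3/2, 5/2} (f(j) = ⌈j^κ⌉)» = «NEW THEORY NEEDED»: «EtTh p.12–13, 16–17,
20 [L2a–f]; II p.107 [L3a/b]; III p.70 [L13d/e]; III p.186 [L4b]» — «Δ²⌈j^κ⌉ is not constant ⇒ O(D_f) is no tensor power of the theta line bundle (Pic by component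
degrees), so no theta-type section/class to evaluate»; row 9 «k5 μ₀ ∈ {27/64, ½, ¾} (μ₀ = 1 print)» = «DEFINABLE, CONSISTENT = print's generalized Θ×μ_LGP-link
(rf-1; PRIOR rows)»: «III p.186 [L4a–e]; III p.159 [L14a–c]; III p.174 [L8b]; III p.69 [L13a/b] vs III p.186 [L4f]» — q-side exponent `λ = 1 + (1 − μ₀)(l(l+1) − 12)/12`
(here `μ₀ = ½`, `l = 107`: `λ = 482`, the cell's numeral — `lambdaLink_half_107` below); row 10 «named pairs / triples» = «word = CONJUNCTION of the components;
no cancelling interaction; PRINT-DEFINABLE on the k2/k3 side only when k2 = k3 = print»: «IV p.27 [Q3-07, Q3-09]; IV p.10 [Q3-05]; II p.72 [Q2-12]; III p.186 [L4b];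
IV p.32 [Q3-13]». The pair's word = NEW-THEORY (k1) ∧ DEFINABLE (k5). Located ≠ adjudicated.

CURRENCY (as in p508362 / p512285 / p513467 / p514474 / p515841; TOPT-LP-SPEC v1.2 §S2/§S3 = REQB-SPEC §1): per place `w`, unit `u_w = ln p/(e_w·l⋆)`; per cell
`(w, j)`, `1 ≤ j ≤ l⋆`: pilot law `f(j) = ⌈j^{3/2}⌉` (= `lawPow 3 j`, p506542), demand `d_j = (f(j) − 1)·m_q`, licensed ⟺ `Cell (lawPow 3) 1 e m D R_in R_out j` ⟺
`margin_j ≥ 0`, exact deficit `def_j = (−margin_j)⁺`; per place `MM_w = Σ_j d_j`, `DD_w = Σ_j def_j`; per datum `M = Σ_w MM_w·u_w`, `K_L1 = Σ_w (MM_w − DD_w)·u_w`;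
«ratio ≥ 1 at target `μ₀`» ⟺ `μ₀·M ≤ K_L1` ⟺ `reqThreshold μ₀ M K_L1 = 0` (`reqThreshold_eq_zero_iff`, p508156). THE DECLARED MAP (`κ = 3/2`) and the place
ledgers `(MM_w, DD_w)` do NOT depend on `μ₀`: rows PK32M12 and PK32M2764 share (a) and the ledgers and differ only in the target of (b) (`½` here, `27/64` there).

WHAT IS PROVED (namespace `Summit.ABC.IUTFork.Repair.RH.ReqsidePairPK32M12`):
* §1 the row's shapes: `placewise_half_iff` — place-wise `½·MM ≤ MM − DD ⟺ 2·DD ≤ MM` (the `decide`-able integer form of this row; the sibling's is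
  `27·MM ≤ 64·(MM − DD)`), `placewise_twentySevenSixtyFourths_of_half` (place-wise, `½` ⟹ `27/64`: the R8-partner direction, cf. the sibling's datum-level
  `pairPK32M2764_of_pairPK32M12`); `ratio_half_eq_two_mul` — AT `μ₀ = ½` THE RATIO OF RECORD IS TWICE THE KEPT FRACTION, `ρ(½) = K_L1/(½·M) = 2·μ_L1` (cells:
  `rho_min` 1.4862 = 2 × `muL1_min` 0.7431 on FREY133; `rho_lowmed` 2.0000 = twice a saturating datum's `μ_L1 = 1`, `ratio_half_of_saturating`); `lambdaLink_half_107`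
  (`1 + (1 − ½)·(107·108 − 12)/12 = 482`, the k5 cell's `λ`).
* §2 (b) PER DATUM: `datum_of_halfKept` — a datum presented as a list of places with integer ledgers `(MM_w, DD_w)`, units `u_w ≥ 0`, `MM_w ≥ 0` and PLACE-WISE
  `2·DD_w ≤ MM_w` has `reqThreshold ½ M K_L1 = 0`; `datum_of_places` — the same from «each place saturating (`DD_w = 0`) or half-kept (`2·DD_w ≤ MM_w`)» = the
  `μ₀ = ½` member of the sibling's `pairPK32M2764_datum_of_places`. The place hypotheses are the bed theorems BY NAME: `DD_w = 0` at the 1,483 saturating places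
  (p513467 `bed_kappaThreeHalves_all` / `_exact_all` via the sibling's `deficitSum_eq_zero_of_floorFree` / `_of_exactFloor`), `2·DD_w ≤ MM_w` at the 47 half-kept
  places (p514474 `bed_kappaThreeHalves_nonsat_halfKept`), `MM_w ≥ 0` (`labelMassSum_nonneg`), `u_w ≥ 0` (`placeUnit_nonneg`) — i.e. EVERY datum of FREY133 ∪ HEX79
  whose places avoid the one exception place `(35, 60, 34, 1, 1, 3)` (132 + 79 data; numeral ↔ datum = CERT-AB-ALL-v411 + reqb-typ-1's census
  k32_places_census.json 0a828bf59b244b3e).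
* §3 (b) THE ONE REMAINING DATUM FREY `…134881:7` (`l = 7`; `M = S/3`, `K_L1 = S/3 − (18/35)·ln 11 − (79/35)·ln 43`, `S = 4·ln 3 + 2·ln 5 + 12·ln 11 + 2·ln 13 +
  12·ln 43 + 2·ln 389 + ln 463 + ln 6841`, p514474 `exception_datum_k32_M_eq` / `_KL1_eq`): `exception_datum` — `reqThreshold ½ M K_L1 = 0` (= p514474
  `exception_datum_k32_words_L1`, second conjunct, by name); `exception_datum_ratio` — `1 ≤ ρ(½) < 3/2` there (from p514474's bracket `M/2 ≤ K_L1 < (3/4)·M`; this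
  datum carries the row's `muL1_min` 0.7431 and `rho_min` 1.4862 on FREY133 — engine numerals, COMPUTED ≠ PROVED). COUNT: (132 + 1)/133 ∧ 79/79 = the row's MEETS.
* §4 (a) THE WORKED PLACE FREY `p = 7`, `l = 107` (`e_w 1605, m_q 210, D 1604, R_in 268, R_out −4472, l⋆ 53`): `worked_face` — every label `j ∈ [1, …, 53]` is a
  `κ = 3/2` cell (`j₀,mod = 53 = l⋆`, seg 1; = p506542 `worked_kappaThreeHalves_all` by name; the label-by-label certificate table `⌈j^{3/2}⌉ = 1, 3, 6, …, 386` is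
  the sibling's `pairPK32M2764_worked_table53` / `_worked_cells`, engine A `licensed_labels 1,…,53 · j0 53 · MM 1752450 · DD 0`) AND the place meets `μ₀ = ½` with
  kept `= MM = 1,752,450` demand units for any unit `u ≥ 0`; `worked_ratio` — the place's own ratio at `½` is exactly `2` (saturating).
HONEST SCOPE (as in the sibling). Every numeral is an engine-certified per-place integer or a cell of the table of record: COMPUTED ≠ PROVED — the theorems
certify integer / real-log arithmetic at the listed numerals and the schematic aggregation; numeral ↔ datum and «these places are all the cell places of that
datum» remain the kit certificate. `κ = 3/2` and `μ₀ = ½` are HYPOTHETICAL parameter settings of OUR typed cell currency (consistency words above: NEW-THEORY /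
DEFINABLE; the pair = CONJUNCTION — located ≠ adjudicated); nothing here says any Θ-datum of [EtTh]/[IUTchI–III] has pilot order `⌈j^{3/2}⌉` or a `λ`-link with
`λ = 482`. Nothing here asserts that abc is proved or refuted, or that [IUTchIII] Cor. 3.12 / [IUTchIV] Thm. 1.10 holds or fails at any datum; no side is taken on
any author; typed ≠ proved; computed ≠ proved; signed ≠ endorsed. [claim: Mochizuki2012, status: disputed] for every IUT locution.
[cite: Mochizuki2012, IUTchIV Prop. 1.4 p. 13, Thm. 1.10 Step (v) p. 27–29; IUTchIII Cor. 3.12 p. 173–174, Rmk. 3.12.1 (ii) p. 186]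
-/

namespace Summit.ABC.IUTFork.Repair.RH.ReqsidePairPK32M12

open Summit.ABC.IUTFork.Repair.RH.ReqsideWeightLaws

/-! ## §1. The row's shapes: the place-wise integer form at `μ₀ = ½`, the R8 direction, `ρ(½) = 2·μ_L1`, and the k5 cell's `λ = 482` -/

/-- **The exact integer form of this row's place-wise comparison**: `½·MM ≤ MM − DD ⟺ 2·DD ≤ MM` (the `decide`-able shape; p514474's
`bed_kappaThreeHalves_nonsat_halfKept` is stated in exactly this form at the 47 half-kept places). [folklore] -/
theorem placewise_half_iff (MM DD : ℤ) :
    (1 / 2 : ℝ) * (MM : ℝ) ≤ ((MM - DD : ℤ) : ℝ) ↔ 2 * DD ≤ MM := by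
  constructor
  · intro h
    have h' : ((2 * DD : ℤ) : ℝ) ≤ ((MM : ℤ) : ℝ) := by push_cast at h ⊢; linarith
    exact_mod_cast h'
  · intro h
    have h' : ((2 * DD : ℤ) : ℝ) ≤ ((MM : ℤ) : ℝ) := by exact_mod_cast h
    push_cast at h' ⊢
    linarith

/-- **R8 direction, place-wise**: a half-kept place (`2·DD ≤ MM`, `MM ≥ 0`) satisfies the sibling row PK32M2764's integer form `27·MM ≤ 64·(MM − DD)`
(datum level: the sibling's `pairPK32M2764_of_pairPK32M12`). [folklore] -/
theorem placewise_twentySevenSixtyFourths_of_half {MM DD : ℤ} (hMM : 0 ≤ MM) (h : 2 * DD ≤ MM) : 27 * MM ≤ 64 * (MM - DD) := by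
  omega

/-- **At `μ₀ = ½` the ratio of record is twice the kept fraction**: `K/(½·M) = 2·(K/M)`, i.e. `ρ(½) = 2·μ_L1` (row cells: `rho_min` 1.4862 = 2 × `muL1_min`
0.7431 on FREY133; on HEX79 `muL1_min` 0.9436, `rho_min` 1.8871). Holds with Lean's `x/0 = 0` convention too. [folklore] -/
theorem ratio_half_eq_two_mul (M K : ℝ) : K / ((1 / 2) * M) = 2 * (K / M) := by
  rw [div_mul_eq_div_div_swap]
  ring

/-- **A saturating datum has `ρ(½) = 2` exactly** (`K_L1 = M ≠ 0`; the row's `rho_lowmed` 2.0000 on both beds). [folklore] -/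
theorem ratio_half_of_saturating {M K : ℝ} (hM : M ≠ 0) (hK : K = M) : K / ((1 / 2) * M) = 2 := by
  rw [ratio_half_eq_two_mul, hK, div_self hM, mul_one]

/-- **The k5 cell's numeral**: print's generalized-link exponent `λ = 1 + (1 − μ₀)·(l(l+1) − 12)/12` at `μ₀ = ½`, `l = 107` is `482` (LOCI row 9; the cell
«λ-link [L4] (l=107: λ = 482)»). Pure arithmetic; nothing about any Θ-datum. [folklore arithmetic at the table's numerals] -/
theorem lambdaLink_half_107 : (1 : ℚ) + (1 - 1 / 2) * ((107 * (107 + 1) - 12) / 12) = 482 := by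
  norm_num

/-! ## §2. (b) Per datum: place-wise `2·DD_w ≤ MM_w` ⟹ `reqThreshold ½ M K_L1 = 0` -/

/-- **ROW PK32M12, PER DATUM, from the place-wise integer comparison**: a datum presented as a list of places with integer ledgers `(MM_w, DD_w)`, units
`u_w ≥ 0`, `MM_w ≥ 0` and `2·DD_w ≤ MM_w` at every place has `reqThreshold ½ M K_L1 = 0`, where `M = Σ MM_w·u_w`, `K_L1 = Σ (MM_w − DD_w)·u_w` — no logarithm is
compared (the sibling's `reqThreshold_eq_zero_of_forall_mem` + `placewise_of_two_mul_deficit_le`). [folklore] -/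
theorem datum_of_halfKept {α : Type*} (L : List α) (MM DD : α → ℤ) (u : α → ℝ)
    (hu : ∀ a ∈ L, 0 ≤ u a) (hMM : ∀ a ∈ L, 0 ≤ MM a) (h : ∀ a ∈ L, 2 * DD a ≤ MM a) :
    reqThreshold (1 / 2) (L.map fun a => (MM a : ℝ) * u a).sum (L.map fun a => ((MM a - DD a : ℤ) : ℝ) * u a).sum = 0 :=
  reqThreshold_eq_zero_of_forall_mem L hu fun a ha => placewise_of_two_mul_deficit_le le_rfl (hMM a ha) (h a ha)

/-- **ROW PK32M12, PER DATUM (the 132 + 79 data avoiding the exception place)** = the `μ₀ = ½` member of the sibling's `pairPK32M2764_datum_of_places`: each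
place SATURATING (`DD_w = 0`: p513467's 1,483 places, via `deficitSum_eq_zero_of_floorFree` / `_of_exactFloor`) or HALF-KEPT (`2·DD_w ≤ MM_w`: p514474
`bed_kappaThreeHalves_nonsat_halfKept`, 47 places), `MM_w ≥ 0` (`labelMassSum_nonneg`), `u_w ≥ 0` (`placeUnit_nonneg`) ⟹ `reqThreshold ½ M K_L1 = 0`.
Numeral ↔ datum = kit certificate. [folklore] -/
theorem datum_of_places {α : Type*} (L : List α) (MM DD : α → ℤ) (u : α → ℝ)
    (hu : ∀ a ∈ L, 0 ≤ u a) (hMM : ∀ a ∈ L, 0 ≤ MM a) (h : ∀ a ∈ L, DD a = 0 ∨ 2 * DD a ≤ MM a) :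
    reqThreshold (1 / 2) (L.map fun a => (MM a : ℝ) * u a).sum (L.map fun a => ((MM a - DD a : ℤ) : ℝ) * u a).sum = 0 :=
  (pairPK32M2764_datum_of_places L MM DD u hu hMM h).2

/-! ## §3. (b) The one remaining datum FREY `…134881:7` (`l = 7`) at `μ₀ = ½`, by name -/

/-- **ROW PK32M12 AT THE EXCEPTION DATUM** (`M = S/3`, `K_L1 = S/3 − (18/35)·ln 11 − (79/35)·ln 43`; engine A's formal sums, p514474 `exception_datum_k32_M_eq` /
`_KL1_eq`): `reqThreshold ½ M K_L1 = 0` — p514474's `exception_datum_k32_words_L1`, second conjunct (there: `M/2 ≤ K_L1` ⟸ `ln 43 ≤ 3·ln 11`). With §2: THE COUNT of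
the row is 133/133 ∧ 79/79 at the tier of record. [folklore] -/
theorem exception_datum :
    reqThreshold (1 / 2) ((4 * Real.log 3 + 2 * Real.log 5 + 12 * Real.log 11 + 2 * Real.log 13 + 12 * Real.log 43 + 2 * Real.log 389
        + Real.log 463 + Real.log 6841) / 3)
      ((4 * Real.log 3 + 2 * Real.log 5 + 12 * Real.log 11 + 2 * Real.log 13 + 12 * Real.log 43 + 2 * Real.log 389
        + Real.log 463 + Real.log 6841) / 3 - 18 / 35 * Real.log 11 - 79 / 35 * Real.log 43) = 0 :=
  exception_datum_k32_words_L1.2.1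

/-- **The exception datum's ratio at `μ₀ = ½` lies in `[1, 3/2)`**: `1 ≤ K_L1/(½·M) < 3/2` (= `2·μ_L1` with p514474's `exception_datum_k32_KL1_bracket`
`M/2 ≤ K_L1 < (3/4)·M`; engine A: `μ_L1 = 0.7431` = the row's `muL1_min`, `ρ(½) = 1.4862` = the row's `rho_min` on FREY133 — COMPUTED ≠ PROVED; the kernel
certifies only the bracket). [folklore] -/
theorem exception_datum_ratio :
    1 ≤ ((4 * Real.log 3 + 2 * Real.log 5 + 12 * Real.log 11 + 2 * Real.log 13 + 12 * Real.log 43 + 2 * Real.log 389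
        + Real.log 463 + Real.log 6841) / 3 - 18 / 35 * Real.log 11 - 79 / 35 * Real.log 43)
      / ((1 / 2) * ((4 * Real.log 3 + 2 * Real.log 5 + 12 * Real.log 11 + 2 * Real.log 13 + 12 * Real.log 43 + 2 * Real.log 389
        + Real.log 463 + Real.log 6841) / 3)) ∧
    ((4 * Real.log 3 + 2 * Real.log 5 + 12 * Real.log 11 + 2 * Real.log 13 + 12 * Real.log 43 + 2 * Real.log 389
        + Real.log 463 + Real.log 6841) / 3 - 18 / 35 * Real.log 11 - 79 / 35 * Real.log 43)
      / ((1 / 2) * ((4 * Real.log 3 + 2 * Real.log 5 + 12 * Real.log 11 + 2 * Real.log 13 + 12 * Real.log 43 + 2 * Real.log 389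
        + Real.log 463 + Real.log 6841) / 3)) < 3 / 2 := by
  have hb := exception_datum_k32_KL1_bracket
  have hrest := exception_datum_rest'_nonneg
  have h := log_11_pos_and_log_43_pos
  have hM : (0 : ℝ) < (1 / 2) * ((4 * Real.log 3 + 2 * Real.log 5 + 12 * Real.log 11 + 2 * Real.log 13 + 12 * Real.log 43
      + 2 * Real.log 389 + Real.log 463 + Real.log 6841) / 3) := by
    linarith [h.1, h.2]
  constructor
  · rw [le_div_iff₀ hM]
    linarith [hb.1]
  · rw [div_lt_iff₀ hM]
    linarith [hb.2]

/-! ## §4. (a) The worked place FREY `p = 7`, `l = 107` under the pair's map, and its word at `μ₀ = ½` -/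

/-- **THE WORKED PLACE UNDER THE PAIR** (`e_w 1605, m_q 210, D 1604, R_in 268, R_out −4472`, `l⋆ = 53`; engine A row `S-k1-kappa3/2 … :107 w p=7`:
`licensed_labels 1,…,53 · j0 53 · seg 1 · MM 1752450 · DD 0`): (a) every label `j ∈ [1, …, 53]` is a `κ = 3/2` cell — `j₀,mod = 53 = l⋆` (p506542
`worked_kappaThreeHalves_all`; label-by-label certificates `⌈j^{3/2}⌉ = 1, 3, 6, …, 386` = the sibling's `pairPK32M2764_worked_cells`), AND (b) the place meets
the row's target: kept `= MM − DD = 1,752,450` demand units against `½·MM`, for any unit `u ≥ 0`. [folklore arithmetic at the table's numerals] -/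
theorem worked_face {u : ℝ} (hu : 0 ≤ u) :
    (∀ j ∈ List.range' 1 53, Cell (lawPow 3) 1 1605 210 1604 268 (-4472) j) ∧
    reqThreshold (1 / 2) ((1752450 : ℝ) * u) ((((1752450 : ℤ) - 0 : ℤ) : ℝ) * u) = 0 := by
  refine ⟨fun j hj => ?_, ?_⟩
  · rw [List.mem_range'_1] at hj
    exact worked_kappaThreeHalves_all hj.1 (by omega)
  · have h := reqThreshold_eq_zero_of_forall_mem [(0 : ℕ)] (μ₀ := 1 / 2) (req := fun _ => ((1752450 : ℤ) : ℝ))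
      (kept := fun _ => (((1752450 : ℤ) - 0 : ℤ) : ℝ)) (u := fun _ => u) (fun _ _ => hu)
      (fun _ _ => placewise_of_deficit_eq_zero (by norm_num) (by norm_num) rfl)
    simpa using h

/-- **The worked place's own ratio at `μ₀ = ½` is exactly `2`** (saturating: `DD = 0`, kept `= MM`), for any unit `u > 0`. [folklore] -/
theorem worked_ratio {u : ℝ} (hu : 0 < u) :
    ((((1752450 : ℤ) - 0 : ℤ) : ℝ) * u) / ((1 / 2) * ((1752450 : ℝ) * u)) = 2 :=
  ratio_half_of_saturating (by positivity) (by push_cast; ring)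

end Summit.ABC.IUTFork.Repair.RH.ReqsidePairPK32M12
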